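import Summits.BirchSwinnertonDyer.BirchSwinnertonDyer.Theorems.ErratumRoadFiveEulerHalfAlphaInertCoker
import HarnessLib

/-!
# Route `ErratumRoadFive`, crux `EulerHalfOffLocus` (item stmt-BirchSwinnertonDyer-19062) — the ¬(ram)
# branch of the inert line, PRELIMINARIES: (DEG) by the Papikian–Rabinoff pairing; ¬(ram) and the class
# X11a pass to the twist by the field of the inert line

Cell `bsd-stepL` (run/shared/lean/pub/bsd-stepL/), seat `bsd-stepL-shim-p1` (prover g4),
`--supports stmt-BirchSwinnertonDyer-19062`. Consumed by `ErratumRoadFiveEulerHalfNotRamInert.lean` (the core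
theorem `missingUpperBoundAt_of_classX11b_of_not_ram_of_inertSet`; mechanism and HONEST FRAMING there and in
seat g3's `ErratumRoadFiveEulerHalfAlphaInert.lean`).

* `padicValNat_delta_empty_eq_of_oddPairing` — (DEG) `ord_p δ(∅) = ord_p δ(S) + Σ_{q∈S} ord_p c_q(E)` from
  (P613) + (Pij) + (P68) + (PEis) + (P618) for an even `S ⊆ Mult` with a half-size subset `R` of ODD primes
  `q`, `p ∤ q − 1` — the induction of `RTDegree.padicValNat_delta_empty_eq_of_pairing`
  (`X11b/BDPRouteRTDegreeTelescope.lean`) re-run on the Lemma-6.18 clause exported by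
  `ribetTakahashiPackageCoker_of_componentOrders` (which carries `Even D.card` and `q ≠ 2`).
* `not_ram_twist_of_inertSet` — a (ram) witness of the twist `E^{d_K}` is a (ram) witness of `E` when every
  prime of the inert set `S` is multiplicative and inert and every other bad prime is split (the inert-set
  analogue of `X11b.not_ram_twist_of_heegner`).
* `classX11a_twist_of_not_ram_inertSet` — the twist of an X11b ∧ ¬(ram) pair by that field, of analytic
  rank `0`, is an X11a pair at `p` (analogue of `X11b.classX11a_twist_of_not_ram`).

THEOREMS ONLY; elementary transports; nothing booked; item 19062 is NOT closed.
-/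

noncomputable section

open scoped Classical

open WeierstrassCurve NumberField IsDedekindDomain Literature.NumberTheory.EllipticCurves
  Rat.HeightOneSpectrum CongruenceSubgroup
  Literature.NumberTheory.EllipticCurves.ModularForms
  Literature.NumberTheory.EllipticCurves.Rank1Residual
  Literature.NumberTheory.EllipticCurves.Rank1Residual.Typed
  Literature.NumberTheory.EllipticCurves.Wuthrich2014
  Literature.NumberTheory.EllipticCurves.BalakrishnanEtAl2019
  Literature.NumberTheory.QuadraticFields.Quadratic
  Literature.NumberTheory.Automorphic
  Summit.BirchSwinnertonDyer.Rank1Residual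
  Summit.BirchSwinnertonDyer.Rank1Residual.X11b

-- the cell's Theorems namespace repeats the summit name (Summit.<Summit>.<Problem>), as in every sibling file
set_option linter.dupNamespace false

namespace Summit.BirchSwinnertonDyer.BirchSwinnertonDyer.Theorems

/-! ### (DEG) by the Papikian–Rabinoff pairing, on the package's Lemma-6.18 clause -/

section OddPairing

variable {ℓ : ℕ} [Fact ℓ.Prime]
  {Mult : Finset ℕ} {δ : Finset ℕ → ℕ} {cA ι κ : Finset ℕ → ℕ → ℕ} {c : ℕ → ℕ}
  -- (P613) Pasten Prop. 6.13 (both expressions, by symmetry in `q`, `r`)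
  (h613 : ∀ ⦃d : Finset ℕ⦄, d ⊆ Mult → Even d.card → ∀ ⦃q r : ℕ⦄, q ∈ Mult → r ∈ Mult →
    q ∉ d → r ∉ d → q ≠ r →
    δ d * ι d q ^ 2 * κ (insert q (insert r d)) r ^ 2 =
      δ (insert q (insert r d)) * cA d q * cA (insert q (insert r d)) r)
  (hδ : ∀ D, 0 < δ D) (hcA : ∀ D q, 0 < cA D q)
  (hij : ∀ ⦃D : Finset ℕ⦄, D ⊆ Mult → ∀ ⦃q : ℕ⦄, q ∈ Mult → ι D q * κ D q = cA D q)
  (hvA : ∀ ⦃D : Finset ℕ⦄, D ⊆ Mult → ∀ ⦃q : ℕ⦄, q ∈ Mult →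
    padicValNat ℓ (cA D q) = padicValNat ℓ (c q))
  (hι : ∀ ⦃d : Finset ℕ⦄, d ⊆ Mult → ∀ ⦃q : ℕ⦄, q ∈ Mult → q ∉ d → padicValNat ℓ (ι d q) = 0)
  -- (P618) in the shape of `ribetTakahashiPackageCoker_of_componentOrders`: even levels, odd primes
  (h618 : ∀ ⦃D : Finset ℕ⦄, D ⊆ Mult → Even D.card → ∀ ⦃q : ℕ⦄, q ∈ D → q ≠ 2 → κ D q ∣ q - 1)

include h613 hδ hcA hij hvA hι h618

/-- **(DEG) from the Papikian–Rabinoff cokernel bound, odd-prime form.** If (P618) `j_q(D) ∣ q − 1` holds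
for the odd primes `q` of every EVEN level `D ⊆ Mult` (the clause exported by the typer's
`PastenShimura2024_componentOrders` through `ribetTakahashiPackageCoker_of_componentOrders`), and the even
set `S ⊆ Mult` has a subset `R` of half its size consisting of ODD primes `q` with `ℓ ∤ q − 1`, then pairing
each prime of `S ∖ R` with one of `R` (cokernel taken on the `R`-side, an `ℓ`-unit) gives
`ord_ℓ δ(∅) = ord_ℓ δ(S) + Σ_{q∈S} ord_ℓ c_q(E)`. The induction of
`RTDegree.padicValNat_delta_empty_eq_of_pairing` (`X11b/BDPRouteRTDegreeTelescope.lean`), verbatim up to the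
two extra arguments of (P618). [cite: PastenShimura2024, Lemma 6.18 and §6.9 (arXiv v4 pp. 32–33)]
[cite: PapikianRabinoff2016, Cor. 3.5] -/
theorem padicValNat_delta_empty_eq_of_oddPairing :
    ∀ (n : ℕ) (S R : Finset ℕ), S ⊆ Mult → R ⊆ S → S.card = 2 * n → R.card = n →
      (∀ q ∈ R, q ≠ 2 ∧ ¬ ℓ ∣ q - 1) →
      padicValNat ℓ (δ ∅) = padicValNat ℓ (δ S) + ∑ x ∈ S, padicValNat ℓ (c x) := by
  intro n
  induction n with
  | zero =>
    intro S R _ _ hS _ _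
    rw [Finset.card_eq_zero.mp (by omega : S.card = 0)]
    simp
  | succ n IH =>
    intro S R hS hRS hScard hRcard hR
    have hSe : Even S.card := ⟨n + 1, by omega⟩
    -- `r ∈ R`, `q ∈ S ∖ R`
    obtain ⟨r, hrR⟩ : R.Nonempty := Finset.card_pos.mp (by omega)
    have hrS : r ∈ S := hRS hrR
    have hne : (S \ R).Nonempty := by
      apply Finset.card_pos.mp
      rw [Finset.card_sdiff_of_subset hRS]; omega
    obtain ⟨q, hq⟩ := hne
    obtain ⟨hqS, hqR⟩ := Finset.mem_sdiff.mp hq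
    have hqr : q ≠ r := fun h ↦ hqR (h ▸ hrR)
    set d := (S.erase q).erase r with hd_def
    have hrq' : r ∈ S.erase q := Finset.mem_erase.mpr ⟨hqr.symm, hrS⟩
    have hSeq : insert q (insert r d) = S := by
      rw [hd_def, Finset.insert_erase hrq', Finset.insert_erase hqS]
    have hdS : d ⊆ S := (Finset.erase_subset _ _).trans (Finset.erase_subset _ _)
    have hd : d ⊆ Mult := hdS.trans hS
    have hqd : q ∉ d := fun h ↦ (Finset.notMem_erase q S) ((Finset.erase_subset r _) h)
    have hrd : r ∉ d := Finset.notMem_erase r _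
    have hdcard : d.card = 2 * n := by
      have h1 := Finset.card_erase_of_mem hqS
      have h2' := Finset.card_erase_of_mem hrq'
      rw [hd_def]; omega
    have hde : Even d.card := ⟨n, by omega⟩
    -- the new `R`
    have hR'd : R.erase r ⊆ d := by
      intro x hx
      obtain ⟨hxr, hxR⟩ := Finset.mem_erase.mp hx
      have hxq : x ≠ q := fun h ↦ hqR (h ▸ hxR)
      exact Finset.mem_erase.mpr ⟨hxr, Finset.mem_erase.mpr ⟨hxq, hRS hxR⟩⟩
    have hR'card : (R.erase r).card = n := by rw [Finset.card_erase_of_mem hrR]; omega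
    have IH' := IH d (R.erase r) hd hR'd hdcard hR'card
      (fun x hx ↦ hR x (Finset.mem_of_mem_erase hx))
    -- the cokernel at `r` of level `S` divides `r - 1`, an `ℓ`-unit
    have hκ : padicValNat ℓ (κ (insert q (insert r d)) r) = 0 := by
      rw [hSeq]
      apply padicValNat.eq_zero_of_not_dvd
      intro hdvd
      exact (hR r hrR).2 (dvd_trans hdvd (h618 hS hSe hrS (hR r hrR).1))
    have := RTDegree.padicValNat_delta_empty_step h613 hδ hcA hij hvA hι hd hde (hS hqS) (hS hrS) hqd
      hrd hqr hκ IH'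
    rwa [hSeq] at this

end OddPairing

/-! ### Transport to the twist by the field of the inert line: ¬(ram) and the class X11a -/

/-- **A (ram) witness of the twist is a (ram) witness of `E`** (so ¬(ram) passes to the twist), for the
Friedberg–Hoffstein field of the inert line: `Wd = Cd • W^{(d_K)}` with `W`, `Wd` globally minimal, every
`ℓ ∈ S` multiplicative for `E` and inert in `K` (`(d_K/ℓ) = −1`, or `ℓ = 2` and `d_K ≡ 5 mod 8`), and `d_K`
a square in `ℚ_ℓ` at every other bad prime `ℓ` of `E`. If `ℓ ≠ p` is multiplicative for `Wd` with
`p ∤ ord_ℓ Δ_min(Wd)`, then `ℓ` is bad for `W` (`j(Wd) = j(W)` is `ℓ`-integral at a good prime: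
`not_hasMultiplicativeReductionAtPrime_of_j_eq`); for `ℓ ∈ S` the twist is unramified at `ℓ` and
`ord_ℓ Δ_min` is unchanged (`padicValInt_minimalDiscriminantInt_twist_eq_of_jacobiSym` ∕ `…_of_mod_eight`);
for `ℓ ∉ S` it is trivial `ℓ`-adically (`hasMultiplicativeReductionAtPrime_quadraticTwist_iff`,
`padicValInt_minimalDiscriminantInt_twist_eq`). The inert-set analogue of `X11b.not_ram_twist_of_heegner`.
[cite: SilvermanAEC2009, VII.5 Prop. 5.1(b), VII.1 Prop. 1.3(b) and X.5 Cor. 5.4] -/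
theorem not_ram_twist_of_inertSet (W : WeierstrassCurve ℚ) [W.IsElliptic] [W.IsGloballyMinimal]
    (p : ℕ) [Fact p.Prime] (K : Type) [Field K] [NumberField K] (S : Finset ℕ)
    (hSin : ∀ ℓ ∈ S, ∃ _ : Fact ℓ.Prime, Mult W ℓ ∧
      ((ℓ ≠ 2 ∧ jacobiSym (NumberField.discr K) ℓ = -1) ∨ (ℓ = 2 ∧ NumberField.discr K % 8 = 5)))
    (hsplit : ∀ (ℓ : ℕ) [Fact ℓ.Prime], ¬ W.HasGoodReductionAtPrime ℓ → ℓ ∉ S →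
      IsSquare (algebraMap ℚ ℚ_[ℓ] (NumberField.discr K : ℚ)))
    (hnram : ¬ Ram W p)
    {Wd : WeierstrassCurve ℚ} [Wd.IsElliptic] [Wd.IsGloballyMinimal] (Cd : VariableChange ℚ)
    (hWd : Cd • W.quadraticTwist (NumberField.discr K : ℚ) = Wd) : ¬ Ram Wd p := by
  rintro ⟨ℓ, hℓ, hℓp, hmultd, hv⟩
  have hD0 : (NumberField.discr K : ℚ) ≠ 0 := by exact_mod_cast NumberField.discr_ne_zero K
  haveI : (W.quadraticTwist (NumberField.discr K : ℚ)).IsElliptic := W.isElliptic_quadraticTwist hD0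
  have hj : Wd.j = W.j := by
    have h1 : Wd.j = (Cd • W.quadraticTwist (NumberField.discr K : ℚ)).j := by subst hWd; rfl
    rw [h1, variableChange_j]
    exact W.j_quadraticTwist hD0
  have hbad : ¬ W.HasGoodReductionAtPrime ℓ := fun hgood ↦
    not_hasMultiplicativeReductionAtPrime_of_j_eq hj ℓ hgood hmultd
  by_cases hℓS : ℓ ∈ S
  · -- inert: the twist is unramified at `ℓ`
    obtain ⟨_, hm, hcase⟩ := hSin ℓ hℓS
    refine hnram ⟨ℓ, hℓ, hℓp, hm, ?_⟩
    rcases hcase with ⟨hℓ2, hJ⟩ | ⟨hℓeq, h8⟩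
    · rwa [← padicValInt_minimalDiscriminantInt_twist_eq_of_jacobiSym W K Cd hWd ℓ hℓ2 hJ]
    · subst hℓeq
      rwa [← padicValInt_minimalDiscriminantInt_twist_eq_of_mod_eight W K Cd hWd h8]
  · -- split: `d_K ∈ ℚ_ℓ^{×2}`
    have hsq := hsplit ℓ hbad hℓS
    refine hnram ⟨ℓ, hℓ, hℓp, ?_, ?_⟩
    · have h := hmultd
      rw [← hWd, hasMultiplicativeReductionAtPrime_smul_iff,
        hasMultiplicativeReductionAtPrime_quadraticTwist_iff W hD0 hsq] at h
      exact h
    · rw [← padicValInt_minimalDiscriminantInt_twist_eq W ℓ hD0 hsq Cd hWd]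
      exact hv

/-- **The twist of an X11b ∧ ¬(ram) pair by the field of the inert line is an X11a pair**: `W` globally
minimal in X11b at `p` (`p ≠ 2` multiplicative, `E[p]` irreducible) with ¬(ram), `p ∈ S` inert
(`(d_K/p) = −1`), the hypotheses of `not_ram_twist_of_inertSet`, and `Wd = Cd • W^{(d_K)}` globally minimal of
analytic rank `0` ⟹ `ClassX11a Wd p` (`r_an = 0`; `p ≠ 2`; multiplicative at `p` — the unramified quadratic
twist of a Tate curve, `mult_twist_of_jacobiSym`; `E^{d}[p]` irreducible —
`hasIrreducibleModPGaloisRep_twist_model`; ¬(ram) — `not_ram_twist_of_inertSet`). The inert-set analogue of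
`X11b.classX11a_twist_of_not_ram`. [cite: SilvermanAEC2009, X.5 Cor. 5.4 and VII.5 Prop. 5.1(b)] -/
theorem classX11a_twist_of_not_ram_inertSet (W : WeierstrassCurve ℚ) [W.IsElliptic]
    [W.IsGloballyMinimal] (p : ℕ) [Fact p.Prime] (hX : ClassX11b W p) (hnram : ¬ Ram W p)
    (K : Type) [Field K] [NumberField K] (h2 : Module.finrank ℚ K = 2)
    (hJp : jacobiSym (NumberField.discr K) p = -1) (S : Finset ℕ)
    (hSin : ∀ ℓ ∈ S, ∃ _ : Fact ℓ.Prime, Mult W ℓ ∧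
      ((ℓ ≠ 2 ∧ jacobiSym (NumberField.discr K) ℓ = -1) ∨ (ℓ = 2 ∧ NumberField.discr K % 8 = 5)))
    (hsplit : ∀ (ℓ : ℕ) [Fact ℓ.Prime], ¬ W.HasGoodReductionAtPrime ℓ → ℓ ∉ S →
      IsSquare (algebraMap ℚ ℚ_[ℓ] (NumberField.discr K : ℚ)))
    {Wd : WeierstrassCurve ℚ} [Wd.IsElliptic] [Wd.IsGloballyMinimal] (Cd : VariableChange ℚ)
    (hWd : Cd • W.quadraticTwist (NumberField.discr K : ℚ) = Wd) (hrd : Wd.analyticRank = 0) :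
    ClassX11a Wd p := by
  obtain ⟨-, hp2, hmult, hirr⟩ := hX
  exact ⟨hrd, hp2, mult_twist_of_jacobiSym W K Cd hWd p hp2 hJp hmult,
    hasIrreducibleModPGaloisRep_twist_model W p K h2 hirr Cd hWd,
    not_ram_twist_of_inertSet W p K S hSin hsplit hnram Cd hWd⟩

end Summit.BirchSwinnertonDyer.BirchSwinnertonDyer.Theorems

end
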